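import Literature.AlgebraicGeometry.Frobenioids.PadicFieldwiseSaturatedTemperedBase
import HarnessLib

/-!
# Frobenioids II, Theorem 2.4 (i), proof p. 20: condition (b) over the RELATIVE Galois coverings `B_D → C_D` of
# `B^temp(Π, Π°)⁰` (print's «Galois covering `φ_D : B_D → C_D`», not only `U ⊴ Π`)

Mochizuki, *The geometry of Frobenioids II*, Kyushu J. Math. **62** (2008) 401–460, §2, proof of Theorem 2.4 (i), p. 20
ll. 14–20 [cite: MochizukiFrdII2008, Thm 2.4 (i) p.20]: "(b) For every pull-back morphism `φ : B → C` of `Cᵢ` that projects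
to a Galois covering `φ_D : B_D → C_D` of `Dᵢ`, the injection `O^⊳(C) → O^⊳(B)` … determines a bijection
`O^⊳(C) ⥲ O^⊳(B)^{Gal(B/C)}` [where … `Gal(B/C) := Gal(B_D/C_D)`]."

PROOF-ONLY file (abc-iut cell, seat abc-iut-w5-d229; SUBDAG-FrdII-Thm24 row **W12-L01b**; no definitions). FIDELITY
REFINEMENT of `PadicFieldwiseSaturatedTemperedBase.lean`: there the class of "Galois coverings" was taken to be
`Γ/U → Γ/V` with `U ⊴ Γ` (Galois OBJECTS of `B^temp(Π)⁰`). Print's (b) quantifies over morphisms `B_D → C_D` that are Galois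
COVERINGS, i.e. — for `f : Γ/U → Γ/V` with `f(1·U) = γV` — `U` normal in the stabiliser `Stab_Γ(γV) = γVγ⁻¹ (⊇ U)` only
(`Γ/U` is then a Galois object of the slice `B^temp(Π)⁰/(Γ/V) ≃ B^temp(γVγ⁻¹)⁰`, with `Gal(B_D/C_D) = γVγ⁻¹/U` acting by right
translations). The relative class is LARGER, so (b) over it is print's (stronger) condition. This file proves the three
binders and the printed equivalence for the relative class, spelled over landed vocabulary as

  `Gal f := ∀ t : Γ, t • f(1·U) = f(1·U) → ∀ u ∈ U, t⁻¹ u t ∈ U`   ("`U` is normalised by `Stab_Γ(f(1·U))`"):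

* `PadicFrd.temperedBase_hdom_rel` (a Galois OBJECT is a Galois covering of anything below it);
* `PadicFrd.temperedBase_hfix_rel` (the Galois-theory argument of `temperedBase_hfix` uses normality of `U` only inside
  `γVγ⁻¹`: the right translations by `γVγ⁻¹` are still endomorphisms of `Γ/U` over `Γ/V`);
* `PadicFrd.Datum.isFieldwiseSaturated_iff_divisible_and_descent_temperedBase_rel` — «FS ⟺ (a) ∧ (b)» with (b) over the
  relative Galois coverings, NO binders, for every `p`-adic Frobenioid datum over `B^temp(Π, Π°)⁰ → D₀`.

Since both equivalences hold, (b) over Galois objects and (b) over Galois coverings are EQUIVALENT given (a)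
(`descent_rel_iff_descent_of_divisible`). Classical; nothing here bears on [IUTchIII] Cor. 3.12; no statement of the paper is
strengthened.
-/

noncomputable section

open CategoryTheory Opposite Function Topology
open Literature.AnabelianGeometry.SemiGraphs

namespace Literature.AlgebraicGeometry.Frobenioids

namespace PadicFrd

open QuasiTemperoid

variable (p : ℕ) [Fact p.Prime] {Γ : Type} [Group Γ] [TopologicalSpace Γ]
  (φ : Γ →* GalFbar ℚ_[p]) (hφ : Continuous φ) (ho : IsOpenMap φ) (hΓ : IsTempered Γ)
  (P : ObjectProperty (CosetCat Γ)) (hP : ∀ {X Y : CosetCat Γ}, (X ⟶ Y) → P Y → P X)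

include hΓ hP in
/-- **`H_dom` for the relative Galois coverings** ([FrdII] Thm. 2.4 (i) proof p. 20, Galois closure): every `Γ/U₁` in
`B^temp(Π, Π°)⁰` is dominated by `Γ/N`, `N ⊴ Γ` open (tempered ⇒ cofinal), and `Γ/N → Γ/U₁ → Γ/V` is a Galois covering of
`Γ/V` (`N` is normalised by everything). [cite: MochizukiFrdII2008, Thm 2.4 (i) p.20] -/
theorem temperedBase_hdom_rel ⦃B₁ C : P.FullSubcategory⦄ (f₁ : B₁ ⟶ C) :
    ∃ (B : P.FullSubcategory) (g : B ⟶ B₁), ∀ t : Γ, t • CosetCat.pt (g ≫ f₁).hom = CosetCat.pt (g ≫ f₁).hom →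
      ∀ u ∈ B.obj.sg, t⁻¹ * u * t ∈ B.obj.sg := by
  obtain ⟨B, g, hN⟩ := temperedBase_hdom hΓ P hP f₁
  exact ⟨B, g, fun t _ u hu => hN.conj_mem' u hu t⟩

/-- **`H_fix` for the relative Galois coverings** (Galois theory through `φ`): for `f : Γ/U → Γ/V`, `f(1·U) = γV`, with `U`
normalised by `Stab_Γ(γV) = γVγ⁻¹` (i.e. `Γ/U → Γ/V` a Galois covering), an element of `K_{Γ/U}` fixed by the field maps of all
endomorphisms of `Γ/U` over `Γ/V` is the image of an element of `K_{Γ/V}` — the right translations by `γVγ⁻¹` are such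
endomorphisms (this is where relative normality is used) and their `φ_*`-images act on `K_{Γ/U} = ℚ̄_p^{g₁φ(U)g₁⁻¹}` through
`g₁ φ(γVγ⁻¹) g₁⁻¹ = Stab(φ_*f (g₁φ(U)))`. [cite: MochizukiFrdII2008, Thm 2.4 (i) p.20] -/
theorem temperedBase_hfix_rel ⦃B C : P.FullSubcategory⦄ (f : B ⟶ C)
    (hGal : ∀ t : Γ, t • CosetCat.pt f.hom = CosetCat.pt f.hom → ∀ u ∈ B.obj.sg, t⁻¹ * u * t ∈ B.obj.sg)
    (x : ((P.ι ⋙ CosetCat.push φ ho ⋙ CosetCat.toConnected (isTempered_galFbar ℚ_[p]) ⋙ galoisPadicFields p).obj B).K)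
    (hx : ∀ σ : B ⟶ B, σ ≫ f = f →
      ((P.ι ⋙ CosetCat.push φ ho ⋙ CosetCat.toConnected (isTempered_galFbar ℚ_[p]) ⋙ galoisPadicFields p).map σ).alg x
        = x) :
    ∃ x₀ : ((P.ι ⋙ CosetCat.push φ ho ⋙ CosetCat.toConnected (isTempered_galFbar ℚ_[p]) ⋙ galoisPadicFields p).obj C).K,
      ((P.ι ⋙ CosetCat.push φ ho ⋙ CosetCat.toConnected (isTempered_galFbar ℚ_[p]) ⋙ galoisPadicFields p).map f).alg x₀
        = x := by
  -- representatives: `f(1·U) = γV`, base point of `G/φ(U)` = `g₁φ(U)`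
  obtain ⟨γ, hγ⟩ := QuotientGroup.mk_surjective (CosetCat.pt f.hom)
  obtain ⟨g₁, hg₁⟩ := QuotientGroup.mk_surjective
    (basePt ((CosetCat.toConnected (isTempered_galFbar ℚ_[p])).obj ((CosetCat.push φ ho).obj B.obj)) :
      ((CosetCat.push φ ho).obj B.obj).carrier)
  have hc : ((φ γ : GalFbar ℚ_[p]) : ((CosetCat.push φ ho).obj C.obj).carrier) =
      CosetCat.pt ((CosetCat.push φ ho).map f.hom) := by
    rw [CosetCat.pt_push_map, ← hγ]; rfl
  refine exists_fieldMap_eq_of_forall_conj p ((CosetCat.push φ ho).map f.hom) hc hg₁ x fun w hw => ?_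
  obtain ⟨v, hv, rfl⟩ := (CosetCat.mem_mapOpen φ ho).mp hw
  -- `γ v γ⁻¹` stabilises `f(1·U) = γV`, hence normalises `U` (relative Galois), hence right translation by it is a
  -- morphism `Γ/U → Γ/U`; it lies over `Γ/V`
  have ht : (γ * v * γ⁻¹) • CosetCat.pt f.hom = CosetCat.pt f.hom := by
    rw [← hγ, MulAction.Quotient.smul_coe, smul_eq_mul, QuotientGroup.eq, show (γ * v * γ⁻¹ * γ)⁻¹ * γ = v⁻¹ by group]
    exact inv_mem hv
  let σ₀ : B.obj ⟶ B.obj :=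
    CosetCat.homMk ((γ * v * γ⁻¹ : Γ) : B.obj.carrier) fun u hu => by
      rw [MulAction.Quotient.smul_coe, smul_eq_mul, QuotientGroup.eq,
        show (u * (γ * v * γ⁻¹))⁻¹ * (γ * v * γ⁻¹) = (γ * v * γ⁻¹)⁻¹ * u⁻¹ * (γ * v * γ⁻¹) by group]
      exact hGal _ ht _ (inv_mem hu)
  have hσ₀ : CosetCat.pt σ₀ = ((γ * v * γ⁻¹ : Γ) : B.obj.carrier) := CosetCat.pt_homMk _ _
  have hσf : (ObjectProperty.homMk σ₀ : B ⟶ B) ≫ f = f := by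
    apply ObjectProperty.hom_ext
    change σ₀ ≫ f.hom = f.hom
    apply CosetCat.hom_ext
    rw [CosetCat.pt_comp, hσ₀, CosetCat.toFun_coe]
    exact ht
  -- its field map fixes `x`; that field map is `a ↦ h' a` with `h' · g₁φ(U) = g₁ φ(γvγ⁻¹) φ(U)`
  have h1 : (fieldMap ((CosetCat.toConnected (isTempered_galFbar ℚ_[p])).map ((CosetCat.push φ ho).map σ₀)) x :
      Fbar ℚ_[p]) = Subtype.val x := congrArg Subtype.val (hx _ hσf)
  have hc' : ((φ (γ * v * γ⁻¹) : GalFbar ℚ_[p]) : ((CosetCat.push φ ho).obj B.obj).carrier) =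
      CosetCat.pt ((CosetCat.push φ ho).map σ₀) := by
    rw [CosetCat.pt_push_map, hσ₀]; rfl
  have hh := carrier_spec ((CosetCat.toConnected (isTempered_galFbar ℚ_[p])).map ((CosetCat.push φ ho).map σ₀))
  rw [← hg₁, ptMap_toConnected_map_mk p _ hc' g₁] at hh
  change carrier ((CosetCat.toConnected (isTempered_galFbar ℚ_[p])).map ((CosetCat.push φ ho).map σ₀)) •
      (g₁ : ((CosetCat.push φ ho).obj B.obj).carrier) =
    ((g₁ * φ (γ * v * γ⁻¹) : GalFbar ℚ_[p]) : ((CosetCat.push φ ho).obj B.obj).carrier) at hh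
  rw [MulAction.Quotient.smul_coe, smul_eq_mul, QuotientGroup.eq] at hh
  rw [fieldMap_apply_of_ρ_eq _ (carrier_spec _)] at h1
  have h2 := ((mem_fixFld_toConnected_iff p _ hg₁ (Subtype.val x)).mp x.2) _ hh
  have h3 : (g₁ * (φ γ * φ v * (φ γ)⁻¹) * g₁⁻¹) (Subtype.val x) =
      (carrier ((CosetCat.toConnected (isTempered_galFbar ℚ_[p])).map ((CosetCat.push φ ho).map σ₀)) *
        (g₁ * ((carrier ((CosetCat.toConnected (isTempered_galFbar ℚ_[p])).map ((CosetCat.push φ ho).map σ₀)) * g₁)⁻¹ *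
          (g₁ * φ (γ * v * γ⁻¹))) * g₁⁻¹)) (Subtype.val x) := by
    congr 1
    rw [map_mul, map_mul, map_inv]
    group
  rw [h3, AlgEquiv.mul_apply, h2, h1]

namespace Datum

include hφ hΓ hP in
/-- **[FrdII] Thm. 2.4 (i), proof p. 20 ll. 9–22: «`Φ` is fieldwise saturated if and only if (a) and (b) hold» with (b) over
print's RELATIVE Galois coverings `B_D → C_D`** — UNCONDITIONAL for every `p`-adic Frobenioid datum over
`B^temp(Π, Π°)⁰ → B^temp(G_{ℚ_p})⁰ → D₀`: (b) = for every `f : Γ/U → Γ/V` that is a Galois covering (`U` normalised by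
`Stab_Γ(f(1·U))`), every effective `b ∈ B(Γ/U)` fixed by all `B(σ)`, `σ` over `Γ/V` (`= Gal(B_D/C_D)`), is `B(f) c` with
`c ∈ B(Γ/V)` effective. [cite: MochizukiFrdII2008, Thm 2.4 (i) p.20] -/
theorem isFieldwiseSaturated_iff_divisible_and_descent_temperedBase_rel (d : Datum P.FullSubcategory p)
    (hd : d.base = P.ι ⋙ CosetCat.push φ ho ⋙ CosetCat.toConnected (isTempered_galFbar ℚ_[p]) ⋙ galoisPadicFields p) :
    d.IsFieldwiseSaturated ↔
      (∀ (C : P.FullSubcategory) (x : d.Φ.obj (op C)) (n : ℕ), 0 < n →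
          ∃ (B : P.FullSubcategory) (f : B ⟶ C) (y : d.Φ.obj (op B)), y ^ n = (d.Φ.map f.op).hom x) ∧
        (∀ ⦃B C : P.FullSubcategory⦄ (f : B ⟶ C),
          (∀ t : Γ, t • CosetCat.pt f.hom = CosetCat.pt f.hom → ∀ u ∈ B.obj.sg, t⁻¹ * u * t ∈ B.obj.sg) →
          ∀ b : d.B.obj (op B),
          (∃ y : d.Φ.obj (op B), Frobenioids.divB d.Φ d.B d.divB (op B) b = Algebra.GrothendieckGroup.of y) →
          (∀ σ : B ⟶ B, σ ≫ f = f → (d.B.map σ.op).hom b = b) →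
          ∃ c : d.B.obj (op C),
            (∃ z : d.Φ.obj (op C), Frobenioids.divB d.Φ d.B d.divB (op C) c = Algebra.GrothendieckGroup.of z) ∧
            (d.B.map f.op).hom c = b) := by
  obtain ⟨base, hloc, hc, he, Φ, ι, hι, hmono, B, toB0, divB, sq, cart, nz⟩ := d
  cases hd
  exact isFieldwiseSaturated_iff_divisible_and_descent _
    (fun ⦃B C : P.FullSubcategory⦄ (f : B ⟶ C) =>
      ∀ t : Γ, t • CosetCat.pt f.hom = CosetCat.pt f.hom → ∀ u ∈ B.obj.sg, t⁻¹ * u * t ∈ B.obj.sg)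
    (temperedBase_hdom_rel hΓ P hP) (temperedBase_hfix_rel p φ ho P) (temperedBase_hram p φ hφ ho P hP)

include hφ hΓ hP in
/-- **The two readings of "Galois" in (b) are interchangeable given (a)**: over `B^temp(Π, Π°)⁰ → D₀`, for a datum satisfying
(a), Galois descent along the Galois OBJECTS `Γ/U`, `U ⊴ Γ` holds iff Galois descent along all relative Galois COVERINGS
`Γ/U → Γ/V` holds (both being equivalent to fieldwise saturation). [cite: MochizukiFrdII2008, Thm 2.4 (i) p.20] -/
theorem descent_rel_iff_descent_of_divisible (d : Datum P.FullSubcategory p)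
    (hd : d.base = P.ι ⋙ CosetCat.push φ ho ⋙ CosetCat.toConnected (isTempered_galFbar ℚ_[p]) ⋙ galoisPadicFields p)
    (ha : ∀ (C : P.FullSubcategory) (x : d.Φ.obj (op C)) (n : ℕ), 0 < n →
      ∃ (B : P.FullSubcategory) (f : B ⟶ C) (y : d.Φ.obj (op B)), y ^ n = (d.Φ.map f.op).hom x) :
    (∀ ⦃B C : P.FullSubcategory⦄ (f : B ⟶ C),
        (∀ t : Γ, t • CosetCat.pt f.hom = CosetCat.pt f.hom → ∀ u ∈ B.obj.sg, t⁻¹ * u * t ∈ B.obj.sg) →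
        ∀ b : d.B.obj (op B),
        (∃ y : d.Φ.obj (op B), Frobenioids.divB d.Φ d.B d.divB (op B) b = Algebra.GrothendieckGroup.of y) →
        (∀ σ : B ⟶ B, σ ≫ f = f → (d.B.map σ.op).hom b = b) →
        ∃ c : d.B.obj (op C),
          (∃ z : d.Φ.obj (op C), Frobenioids.divB d.Φ d.B d.divB (op C) c = Algebra.GrothendieckGroup.of z) ∧
          (d.B.map f.op).hom c = b) ↔
      (∀ ⦃B C : P.FullSubcategory⦄ (f : B ⟶ C), B.obj.sg.toSubgroup.Normal → ∀ b : d.B.obj (op B),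
        (∃ y : d.Φ.obj (op B), Frobenioids.divB d.Φ d.B d.divB (op B) b = Algebra.GrothendieckGroup.of y) →
        (∀ σ : B ⟶ B, σ ≫ f = f → (d.B.map σ.op).hom b = b) →
        ∃ c : d.B.obj (op C),
          (∃ z : d.Φ.obj (op C), Frobenioids.divB d.Φ d.B d.divB (op C) c = Algebra.GrothendieckGroup.of z) ∧
          (d.B.map f.op).hom c = b) := by
  constructor
  · intro hb
    exact ((isFieldwiseSaturated_iff_divisible_and_descent_temperedBase p φ hφ ho hΓ P hP d hd).mp
      ((isFieldwiseSaturated_iff_divisible_and_descent_temperedBase_rel p φ hφ ho hΓ P hP d hd).mpr ⟨ha, hb⟩)).2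
  · intro hb
    exact ((isFieldwiseSaturated_iff_divisible_and_descent_temperedBase_rel p φ hφ ho hΓ P hP d hd).mp
      ((isFieldwiseSaturated_iff_divisible_and_descent_temperedBase p φ hφ ho hΓ P hP d hd).mpr ⟨ha, hb⟩)).2

end Datum

end PadicFrd

end Literature.AlgebraicGeometry.Frobenioids

end
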